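import Mathlib
import HarnessLib
import HarnessLib.Audit
import Summits.QuantumFields.Statement
import Summits.QuantumFields.YangMills.Theorems.WeakCouplingRates
import HarnessLib.Audit.Status.Attr

/-!
Route: AllGroupsColdBox

CLOSED (superseded) 2026-08-27T22:28:12Z by planner-ym-idea-5-g2-0 — reason: superseded:route-QuantumFields-ColdBoxAllGroups — superseded by route-QuantumFields-ColdBoxAllGroups — note: same X = BOX_G ∧ BULK_G transplant of the closed SU(2) architecture via massGapPowerDecayOf_of_box (director-ym decision 2026-08-27T21:03:38Z on idea-crit-5's duplication flag); the one distinct idea (BULK_G by local log-concavity of the cold-conditioned DLR kernel + Brascamp–Lieb + synchronous coup. The file is kept as the record of this route; refuted decls are indexed as negative knowledge (`ledger negatives`).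

# Route AllGroupsColdBox — cold-box PT plus log-concave coupling for BULK give xi >= beta^eps for
every compact simple G

It suffices to show X = BULK_G ∧ BOX_G (∧ the closed G-independent FLOOR): for EVERY compact simple
Lie group G and faithful unitary lattice representation r — not only SU(2) — (BOX_G,
ColdBoxTwoPointFloorAllG) the periodic cold box of side ⌈β^θ⌉ has plaquette–plaquette covariance at
separation ⌈β^A⌉ at least c·(lattice-Maxwell curvature number c_n)²/β² (second-order lattice
perturbation theory in the exponential chart of G), and (BULK_G, BulkDominatesColdBoxAllG) every
large torus dominates a fixed fraction η of that cold-box covariance (the infinite-volume step).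
With the tree's kernel `massGapPowerDecayOf_of_box` (generic in G, ρ) this gives
`MassGapPowerDecayOf 4 r.ρ (A/2)` for all G, r: the all-G leaf XiPow. HONEST LABEL: the registered
rung R2ξ `XiPowSU2` is ALREADY CLOSED in the tree (`xiPowSU2_holds`, 2026-08-27) by exactly this
architecture typed for SU(2) (64 of its ~130 Theorems files are SU(2)/quaternion-chart specific:
`boxKernel`, `CrudeGood`, gnomonic charts, `…LargeFieldSU2`); the content of this line is the OPEN
all-G leaf `XiPow` (Assembly BULK_G → BOX_G → FLOOR → XiPow kernel-checked; closes =
`xiPowSU2_of_xiPow` ∘ Assembly), filed under closes_target R2ξ only because XiPow is not yet a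
registered closer (request «to director-ym» to register R2ξ′ and re-point). bears_on: R2ξ′ (XiPow).
A TRANSPLANT line (claimed grade: variant) whose new content is the general-G chart/large-field
analysis and — the seat's technique card — a COUPLING proof of BULK_G (log-concavity of the
cold-conditioned DLR kernel in the exponential chart ⇒ Brascamp–Lieb / synchronous-coupling control
of the exterior's influence), replacing the SU(2) cluster plumbing. No summit is proved; NOT the
Clay gap (an UPPER bound on the gap).
Lean: `BulkDominatesColdBoxAllG ∧ ColdBoxTwoPointFloorAllG ∧ CurvatureCorrPowerFloor`

## Assembly
The deciding theorem `closes (hA : Assembly) (hBulk) (hBox) (hF) : XiPowSU2 := xiPowSU2_of_xiPow (hA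
hBulk hBox hF)` consumes every item; the Assembly item is PROVABLE NOW (kernel-checked in the seat's
line2/Sketch.lean, `assembly_holds`): for G, r, BOX_G gives θ₀; BULK_G at θ₀ gives A, θ and `hbulk`;
BOX_G at (A, θ) gives c and `hb`; `massGapPowerDecayOf_of_box r.ρ r.continuous hA hc hb hbulk hF :
MassGapPowerDecayOf 4 r.ρ (A/2)` — hence XiPow with ε = A/2. Lean proof for the prover: `intro hBulk
hBox hF G _ _ _ _ hG; letI : MeasurableSpace G := borel G; haveI : BorelSpace G := ⟨rfl⟩; intro r;
obtain ⟨θ₀, hθ₀, hbox⟩ := hBox G hG r; obtain ⟨A, θ, hA, hAθ, hθ, hbulk⟩ := hBulk G hG r θ₀ hθ₀;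
obtain ⟨c, hc, hb⟩ := hbox A θ hA hAθ hθ; exact ⟨A / 2, by positivity, massGapPowerDecayOf_of_box
r.ρ r.continuous hA hc hb hbulk hF⟩`. A rung line; proves no summit.

CLOSES_TARGET: closes rung R2xi of QuantumFields: Summit.QuantumFields.YangMills.Theorems.WeakCouplingRates.XiPowSU2 (D-0061; not the summit Statement) — the deciding theorem of this route concludes that registered leaf instead of the Statement decl `YangMills` (class rung: servable and labelled, never counted as concluding the summit Statement).

Rationale: WHY THIS LINE. The ξ-rung for SU(2) closed today through BOX_W ∧ BULK_W ∧ FLOOR (route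
WeakCouplingRates); the ladder's next rung is the same power law for every compact simple G (leaf
`XiPow`, `xiPowSU2_of_xiPow` proved). The kernel glue `massGapPowerDecayOf_of_box`, the currencies
`boxPlaqCov`/`torusPlaqCov`/`BoxTwoPointDomination`/`BulkDominatesBox` and the FLOOR are already
generic in (G, ρ); what is SU(2)-specific in the landed proof is the chart (unit quaternions,
gnomonic coordinates), the one-link large-field rarity and the cluster bookkeeping of BULK. This
line re-asks the two W statements verbatim over all compact simple G and proposes, for BULK_G, the
probabilistic mechanism absent from the SU(2) proof: in the exponential chart exp : 𝔤^(edges) →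
G^(edges) restricted to the cold event and axial gauge, −log of the DLR density is β·(lattice
Maxwell form ⊗ Killing) + O(β·|X|³), uniformly convex on the cold ball, so Brascamp–Lieb bounds
every gauge-invariant variance by the Dirichlet–Maxwell Green quadratic form and the synchronous
coupling of the Langevin dynamics for two exteriors contracts — the exterior's influence on the
separation-⌈β^A⌉ covariance deep inside is bounded by the massless boundary-to-bulk kernel (box
⌈β^θ⌉ ≫ ⌈β^A⌉), which is BULK domination with η = 1 − o(1) (Shen–Zhu–Zhu arXiv:2204.12737 run
Bakry–Émery GLOBALLY at strong coupling; here it is run LOCALLY on the cold-conditioned kernel at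
weak coupling). BOX_G is Laplace asymptotics on a finite-dimensional compact manifold (any G: N − Re
tr ρ(g) ≥ c·d(g,1)² for faithful ρ by compactness and the Killing form). Imported areas: log-concave
functional inequalities / coupling of diffusions (probability), lattice perturbation theory. Versus
listed routes: WeakCouplingRates is SU(2)-typed and closed; EquipartitionCriticality reaches only
the qualitative XiDiv for all G; DirichletWindow / XiCompleteMonotonicity state all-G windows for
the RAW plaquette correlator of limit states but own no BULK mechanism; SoftLoopVariational (this
seat's LINE 1) avoids BULK altogether — this line is the complementary, architecture-conservative
transplant.

RANKED CRUXES. #2 BulkDominatesColdBoxAllG (crux) — (BULK_G) for every compact simple G, faithful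
unitary r and every θ₀ > 0 there are exponents 0 < A < θ ≤ θ₀ such that `BulkDominatesBox r.ρ A θ`:
some η > 0, for β ≥ β₀ and all large tori L, η · Cov_(cold box ⌈β^θ⌉)(c_p, c_(p+⌈β^A⌉e₀)) ≤
Cov_(torus L)(same pair). [difficulty: L] (why it might fail: for general G the cold event must
avoid ALL non-identity critical points of Re tr ρ and sub-horizon large fields must be rare
uniformly in the volume (the SU(2) proof used one-link quaternion geometry); log-concavity holds
only inside the cold ball, so the coupling needs a boundary rejection step.) [arXiv:2204.12737,
ChatterjeeYMProb2019, arXiv:2511.07297]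
#3 ColdBoxTwoPointFloorAllG (crux) — (BOX_G) for every compact simple G and faithful unitary r there
is θ₀ > 0 such that for all exponents 0 < A < θ ≤ θ₀ there is c > 0 with `BoxTwoPointDomination r.ρ
A θ c`: for β ≥ β₀, c·c_(⌈β^A⌉)² ≤ β²·Cov_(cold box ⌈β^θ⌉)(c_p, c_(p+⌈β^A⌉e₀)) — second-order
lattice perturbation theory in one periodic cold box, exponential chart of G. [difficulty: L] (why
it might fail: the Wick term is (dim G)(Killing-normalised)·c_n²/β² but the relative remainder must
be o(β^(−8A)) since c_n² ≍ n^(−8) at n = β^A; for general G the cubic chart terms (structure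
constants) and the Haar Jacobian of exp are of relative size β^(−1/2+O(θ)) only for θ small.)
[doi:10.1016/0370-2693(81)90037-x, ChatterjeeYMProb2019, doi:10.1017/cbo9780511470783]
#9 CurvatureCorrPowerFloor (support) — (FLOOR, G-independent, the tree's CLOSED item of route
WeakCouplingRates verbatim — re-asked so that the deciding theorem's cone is self-contained) κ/n⁴ ≤
|c_n| for n ≥ n₀, c_n the lattice-Maxwell curvature two-point number. [difficulty: provable-now]
[ChatterjeeYMProb2019]

TWO-LAYER PLAN. BULK_G ⇐ B1 (cold typicality in every volume for general G: chessboard +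
`freeEnergyLogCoefficient_proof`, all G in tree) → B2 (log-concave coupling: exterior influence on
the deep covariance ≤ massless boundary kernel · β^(O(θ)), Brascamp–Lieb + synchronous coupling with
boundary rejection) → BULK_G. BOX_G ⇐ X1 (exponential-chart Wick term with Killing normalisation) →
X2 (cubic/Jacobian remainder o(β^(−8A))) → BOX_G.

KILL CRITERIA. A refutation of BOX_G (e.g. a G and faithful r for which the cold-box covariance at
separation β^A is parametrically SMALLER than c_n²/β² — impossible at leading order unless the Wick
term cancels, which the Killing form forbids) closes the route `refuted:ColdBoxTwoPointFloorAllG`; a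
refutation of BULK_G forces the pivot to LINE 1 (SoftLoopVariational, no BULK). XiPow proved by any
other all-G route moots it.

NOT DECOMPOSED YET. Which chart (exponential vs. Cayley), the large-field thresholds, the admissible
(A, θ) window for general G, and whether the coupling proof of BULK_G gives η = 1 − o(1) or only η >
0 are layer-2 matters.

CHEAPEST FALSIFIER. For G = SU(3), fundamental r: compute the leading Wick coefficient of
β²·Cov_box(c_p, c_(p+n e₀)) in the exponential chart — it must equal (dim G / normalisation)·c_n²
with a POSITIVE G-dependent constant (Casimir bookkeeping, one page); a vanishing constant for some
(G, r) kills BOX_G. Second: check in Lean that `BoxTwoPointDomination`, `BulkDominatesBox`,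
`massGapPowerDecayOf_of_box` elaborate for a general `LatticeRep` (done: line2/Sketch.lean rc 0).

NUMBERS. A < θ ≤ θ₀ with θ₀ ≤ 1/100 in the SU(2) proof (`stub_boxGaussianDomination`); ε = A/2. dim
SU(N) = N²−1; Killing normalisation of the Wick term ∝ C₂(r)·dim r / N.

DEFINITION REQUESTS. None (all currencies generic in G: `boxPlaqCov`, `torusPlaqCov`,
`BoxTwoPointDomination`, `BulkDominatesBox`, `MassGapPowerDecayOf`).

Novelty: Searches (2026-08-27): lit search --hybrid "Bakry-Emery log-Sobolev lattice Yang-Mills mass gap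
stochastic analysis Langevin coupling" (6 docs; [corpus:book:montvay1994-quantum-fields-lattice
p.398] Langevin simulation only); lit search "Shen Zhu Zhu stochastic analysis lattice Yang-Mills"
--source all ([corpus:paper:arxiv-2204.12737 p.26–27] Bakry–Émery mass gap at STRONG coupling;
[corpus:paper:arxiv-2511.07297 p.13] leading-order free energy, general G;
[corpus:paper:arxiv-2505.16585 p.27]); lit galaxy search "lattice
Yang-Mills|Bakry-Emery|Brascamp-Lieb" --star pdf (8 rows: [galaxy:pdf:6344137362336657480] Poincaré
constant of log-concave measures, [galaxy:pdf:-5992477456443508120] log-concave coupling — generic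
tools, no gauge-theory weak-coupling use); tree: Theses WeakCouplingRates (SU(2), closed),
XiCompleteMonotonicity, DirichletWindow, EquipartitionCriticality; `ledger negatives --problem
QuantumFields` (7, none on rates).
Nearest prior art found: route-QuantumFields-WeakCouplingRates (`xiPowSU2_holds`, SU(2));
arXiv:2204.12737 (Shen–Zhu–Zhu, Bakry–Émery at strong coupling); ChatterjeeYMProb2019 Problem 5.1.
Delta: the landed SU(2) architecture transplanted to every compact simple G, with the
infinite-volume BULK step re-founded on local log-concavity of the cold-conditioned DLR kernel
(Brascamp–Lieb + synchronous coupling) instead of SU(2) cluster plumbing.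
Claimed grade: variant  [refs: 2204.12737, book:montvay1994-quantum-fields-lattice, paper:arxiv-2204.12737, paper:arxiv-2511.07297, paper:arxiv-2505.16585, ChatterjeeYMProb2019]

Barriers (technique_class: lattice-pt, log-concave-coupling, dlr-conditioning): - technique_class: lattice-pt, log-concave-coupling, dlr-conditioning
- Literature.Barriers.QuantumFields.ElitzurTheorem: outside — only gauge-invariant plaquette
covariances are estimated; axial gauge and the exponential chart are proof-internal coordinates.
- Literature.Barriers.QuantumFields.DiluteInstantonGasDivergence: not applicable — one cold box of
polynomial size, Gaussian + bounded remainder; no instanton or multi-scale sum. (Uncatalogued but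
relevant: discrete-subgroup freezing `actionGap_pos_of_finite` — the leaf quantifies over compact
simple LIE groups only; Shen–Zhu–Zhu's global Bakry–Émery works only for β small, here curvature is
supplied by β·Hessian on the cold ball, not by Ric(G).)
- Literature.Barriers.QuantumFields.AbelianDeconfinementD4: not applicable — an UPPER bound on the
gap, true also in the Coulomb phase of U(1).
- Negatives index: none of the 7 refuted YangMills statements concerns weak-coupling rates;
RobustYangMillsRG (14958) and AdaptiveCoarseSystem (9494) were multi-scale RG claims — this line is
single-scale.

History (route lifecycle, newest last):
- 2026-08-27T22:28:13Z · CLOSED superseded — superseded:route-QuantumFields-ColdBoxAllGroups (planner-ym-idea-5-g2-0)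

sub-problem: YangMills · status: closed(superseded) · opened planner-ym-idea-5-g0-0 2026-08-27T20:42:38Z · rev 0 · ledger route-QuantumFields-AllGroupsColdBox
GENERATED by the gate from the ledger (D-0016/17). Provers cite these decls: `theorem foo : Summit.QuantumFields.YangMills.Theses.AllGroupsColdBox.<Decl> := …` in Summits/QuantumFields/YangMills/Theorems/<Name>.lean.
-/

namespace Summit.QuantumFields.YangMills.Theses.AllGroupsColdBox

open scoped BigOperators Topology Manifold Classical MeasureTheory ProbabilityTheory Matrix InnerProductSpace ComplexConjugate ContinuousMap
open Filter Set Function TopologicalSpace MeasureTheory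

attribute [summit_statement] _root_.YangMills
attribute [summit_statement] _root_.Summit.QuantumFields.YangMills.Theorems.WeakCouplingRates.XiPowSU2

/-- item stmt-QuantumFields-22301 · crux · rank 2 · closed · moot by None · by planner
why it might fail: for general G the cold event must avoid ALL non-identity critical points of Re tr ρ and sub-horizon large fields must be rare uniformly in the volume (the SU(2) proof used one-link quaternion geometry); log-concavity holds only inside the cold ball, so the coupling needs a boundary rejection step.
sources: arXiv:2204.12737, ChatterjeeYMProb2019, arXiv:2511.07297
[crux] (BULK_G) for every compact simple G, faithful unitary r and every θ₀ > 0 there are exponents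
0 < A < θ ≤ θ₀ such that `BulkDominatesBox r.ρ A θ`: some η > 0, for β ≥ β₀ and all large tori L, η
· Cov_(cold box ⌈β^θ⌉)(c_p, c_(p+⌈β^A⌉e₀)) ≤ Cov_(torus L)(same pair). [difficulty: L] -/
@[route_item "route-QuantumFields-AllGroupsColdBox", crux]
def BulkDominatesColdBoxAllG : Prop :=
  ∀ (G : Type) [Group G] [TopologicalSpace G] [IsTopologicalGroup G] [CompactSpace G] [MeasurableSpace G] [BorelSpace G], Literature.MathematicalPhysics.QuantumFieldTheory.IsCompactSimpleLieGroup G → ∀ r : Literature.MathematicalPhysics.QuantumFieldTheory.LatticeRep G, ∀ θ₀ : ℝ, 0 < θ₀ → ∃ A θ : ℝ, 0 < A ∧ A < θ ∧ θ ≤ θ₀ ∧ Summit.QuantumFields.YangMills.Theorems.WeakCouplingRates.BulkDominatesBox (G := G) r.ρ A θ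

/-- item stmt-QuantumFields-22302 · crux · rank 3 · closed · moot by None · by planner
why it might fail: the Wick term is (dim G)(Killing-normalised)·c_n²/β² but the relative remainder must be o(β^(−8A)) since c_n² ≍ n^(−8) at n = β^A; for general G the cubic chart terms (structure constants) and the Haar Jacobian of exp are of relative size β^(−1/2+O(θ)) only for θ small.
sources: doi:10.1016/0370-2693(81)90037-x, ChatterjeeYMProb2019, doi:10.1017/cbo9780511470783
[crux] (BOX_G) for every compact simple G and faithful unitary r there is θ₀ > 0 such that for all
exponents 0 < A < θ ≤ θ₀ there is c > 0 with `BoxTwoPointDomination r.ρ A θ c`: for β ≥ β₀,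
c·c_(⌈β^A⌉)² ≤ β²·Cov_(cold box ⌈β^θ⌉)(c_p, c_(p+⌈β^A⌉e₀)) — second-order lattice perturbation
theory in one periodic cold box, exponential chart of G. [difficulty: L] -/
@[route_item "route-QuantumFields-AllGroupsColdBox", crux]
def ColdBoxTwoPointFloorAllG : Prop :=
  ∀ (G : Type) [Group G] [TopologicalSpace G] [IsTopologicalGroup G] [CompactSpace G] [MeasurableSpace G] [BorelSpace G], Literature.MathematicalPhysics.QuantumFieldTheory.IsCompactSimpleLieGroup G → ∀ r : Literature.MathematicalPhysics.QuantumFieldTheory.LatticeRep G, ∃ θ₀ : ℝ, 0 < θ₀ ∧ ∀ A θ : ℝ, 0 < A → A < θ → θ ≤ θ₀ → ∃ c : ℝ, 0 < c ∧ Summit.QuantumFields.YangMills.Theorems.WeakCouplingRates.BoxTwoPointDomination (G := G) r.ρ A θ c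

/-- item stmt-QuantumFields-22303 · support · rank 9 · closed · moot by None · by planner
sources: ChatterjeeYMProb2019
[support] (FLOOR, G-independent, the tree's CLOSED item of route WeakCouplingRates verbatim —
re-asked so that the deciding theorem's cone is self-contained) κ/n⁴ ≤ |c_n| for n ≥ n₀, c_n the
lattice-Maxwell curvature two-point number. [difficulty: provable-now] -/
@[route_item "route-QuantumFields-AllGroupsColdBox", crux]
def CurvatureCorrPowerFloor : Prop :=
  ∃ κ : ℝ, 0 < κ ∧ ∃ n₀ : ℕ, ∀ n : ℕ, n₀ ≤ n → κ / (n : ℝ) ^ 4 ≤ |Literature.MathematicalPhysics.QuantumFieldTheory.curvaturePlaquetteCorr (d := 4) (by norm_num) (n : ℤ)|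

/-- item stmt-QuantumFields-22304 · crux (kind.auto-crux: conjecture-grade) · rank 1 · closed · moot by None · by planner
why it might fail: auto-crux — conjecture-grade statement (statement references the registered conjecture Summit.QuantumFields.YangMills.Theorems.WeakCouplingRates.XiPow); it is open, so it may simply be false
sources: ChatterjeeYMProb2019
[assembly] BULK_G → BOX_G → FLOOR → XiPow (all compact simple G); provable now (proof above). -/
@[route_item "route-QuantumFields-AllGroupsColdBox", crux]
def Assembly : Prop :=
  BulkDominatesColdBoxAllG → ColdBoxTwoPointFloorAllG → CurvatureCorrPowerFloor → Summit.QuantumFields.YangMills.Theorems.WeakCouplingRates.XiPow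

/-! D-0027 §2.1 — DECIDING THEOREM (planner-authored via `route open/edit --closes-file`; by planner-ym-idea-5-g0-0 2026-08-27T20:42:38Z) — ARCHIVED: route closed (superseded) 2026-08-27T22:28:12Z; kept so importers keep building:
its hypotheses are this route's items and its conclusion the registered leaf `Summit.QuantumFields.YangMills.Theorems.WeakCouplingRates.XiPowSU2` (rung R2xi, D-0061) (glue_lint), and it elaborates with this file. -/

@[closes "route-QuantumFields-AllGroupsColdBox"] theorem closes (hA : Summit.QuantumFields.YangMills.Theses.AllGroupsColdBox.Assembly)
    (hBulk : Summit.QuantumFields.YangMills.Theses.AllGroupsColdBox.BulkDominatesColdBoxAllG)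
    (hBox : Summit.QuantumFields.YangMills.Theses.AllGroupsColdBox.ColdBoxTwoPointFloorAllG)
    (hF : Summit.QuantumFields.YangMills.Theses.AllGroupsColdBox.CurvatureCorrPowerFloor) :
    Summit.QuantumFields.YangMills.Theorems.WeakCouplingRates.XiPowSU2 :=
  -- HONEST LABEL: rung R2ξ (SU(2)) is closed in tree (`xiPowSU2_holds`); the content is the OPEN all-G leaf `XiPow`
  -- = `hA hBulk hBox hF` (Assembly provable now via `massGapPowerDecayOf_of_box`, kernel-checked in the seat's Sketch).
  Summit.QuantumFields.YangMills.Theorems.WeakCouplingRates.xiPowSU2_of_xiPow (hA hBulk hBox hF)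

end Summit.QuantumFields.YangMills.Theses.AllGroupsColdBox
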